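import Summits.Schanuel.Schanuel.Theorems.RootDecomp1KDescentEven01

/-!
# RootDecomp1KDescentEven (part 02 of 03) — CENSUS PROVENANCE for lens-1 g72 NODE 33 «THE EVEN TWIST» (CLAIM L3256; crit-1 (g13) PRICE NODE 33 L3259: ×0-AS-RECORD under RULE K-R50 (i) — a λ-support / twist-argument extension of node 19's 2-descent engine —, PORT WELCOME; NODE L3266; crit AUDIT NODE 33 / PORT GO L3269: «NODE 33 STANDS AS A THEOREM — DJ 2 (row 42) and the class DJ (2^v·3^j) decided hypothesis-free at LevelFinite / ThinFibreAt m₀ ∀ m₀; CREDIT ×0-AS-RECORD»; on PORT IDENTITY the census ledger moves row 42 → decided, UNDECIDED OF RECORD ×2 → ×1 = {36 W4})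

(census-1 g27 ×0 record port, `--supports stmt-Schanuel-33364`, no credit to anyone.  SOURCE: the lens's kernel HOME/decomp-schanuel-lens-1/g72/lean/DescentEven.lean sha256 e3ef4100266c9735… (717 l; ONE import `…RootDecomp1KDescent06`; ONE namespace `…Theorems.RootDecomp1KDescentEven` + `section Territory`; 26 theorems + `structure DescentCertE` + `def djCertE`; lens farm rc 0 · 0 sorries · 64 dupNamespace; critic AUDIT L3269: byte identity, farm rc 0, `--axioms` standard ×7, probe rc 0 / CTRL rc 1 (DJ 5), row-42 identity term by term, dependency walker Ridout-free / Literature-free with its own engine `levelFinite_of_descentCertE`) split by the census at the §3/§4 and §5/§6 boundaries for the 400-line cap: part 01 = K l.1–294 (module docstring; §0 small facts; §1 the descent lemma `descent_ev`; §2 the 2-adic Runge step `sign_choice_ev` / `runge_cover_ev`; §3 `structure DescentCertE`); part 02 = K l.295–567 (§4 `exists_sign_small_ev`; §5 the engine `nu_root_of_level_ev` / `levelFinite_of_descentCertE` / `thinFibreAt_of_descentCertE`); part 03 = K l.568–717 (§6 the class DJ (2^v·3^j): `dsNu_dj_ne_zero_even` … `def djCertE` … `levelFinite_DJ2` / `thinFibreAt_DJ2`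 / `bev_DJ2` / `DJ2_not_mem_odd_class`; section Territory `DJ2_decided`); parts 02 / 03 re-open the header (noncomputable section / namespace / the 13 `open` lines = K l.26–44 verbatim) behind `import …RootDecomp1KDescentEven0(k−1)`.  Bodies BYTE-VERBATIM; port-side modifiers: (m1) the three §0 helpers `norm_intCast_le_one_ev` / `isCoprime_num_den_ev` / `odd_psNumer_ev` (gate near-duplicate flags against declarations outside the import cone) are MOVED from part 01 to THIS part as `private` theorems next to their only uses, bodies verbatim; nothing else renamed or changed.  Rung 0; nothing here proves Schanuel, 33364, 33363, 31077, 31987, `ThinFibre 2`, W4 or a binder.)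
-/

/-!
# RootDecomp1KDescentEven02 — lens 1, generation 72, NODE 33 «THE EVEN TWIST» — continuation (§4 the lift `exists_sign_small_ev`; §5 the engine `nu_root_of_level_ev`, `levelFinite_of_descentCertE`, `thinFibreAt_of_descentCertE`); module docstring of record in part 01.
-/

noncomputable section

namespace Summit.Schanuel.Schanuel.Theorems.RootDecomp1KDescentEven

open Polynomial LiouvilleNumber
open scoped Nat
open Summit.Schanuel.Schanuel.Theorems.RootDecomp1KTwoBaseCell (psNumer partialSum_eq_psNumer_div coprime_psNumer)
open Summit.Schanuel.Schanuel.Theorems.RootDecomp1KRelLiouvilleCell (partialSum_two_strictMono)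
open Summit.Schanuel.Schanuel.Theorems.RootDecomp1KDegreeLadder
open Summit.Schanuel.Schanuel.Theorems.RootDecomp1KXLinear
open Summit.Schanuel.Schanuel.Theorems.RootDecomp1KXLinearII
open Summit.Schanuel.Schanuel.Theorems.RootDecomp1KXTop
open Summit.Schanuel.Schanuel.Theorems.RootDecomp1KXAll
open Summit.Schanuel.Schanuel.Theorems.RootDecomp1KLevelFinite
open Summit.Schanuel.Schanuel.Theorems.RootDecomp1KThueMahler
open Summit.Schanuel.Schanuel.Theorems.RootDecomp1KParamThueMahler
open Summit.Schanuel.Schanuel.Theorems.RootDecomp1KLocalExponent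
open Summit.Schanuel.Schanuel.Theorems.RootDecomp1KRunge
open Summit.Schanuel.Schanuel.Theorems.RootDecomp1KDescent

/-! PORT NOTE (census-1 g27): the three small helpers below sit in K §0 (l.49 / l.55 / l.61); the gate flags them as
near-duplicates of tree declarations outside this file's import cone (`RootDecomp1KCollarCell.odd_psNumer_two`,
`Literature…SparseDyadicRationals.isCoprime_num_den`, a BSD-side `norm_intCast_padicAlgCl_two_le_one`), so the port keeps
them PRIVATE next to their only uses (this part), bodies verbatim. -/

/-- `‖(z : ℂ₂)‖ ≤ 1` for integers. -/
private theorem norm_intCast_le_one_ev (z : ℤ) : ‖(z : PadicAlgCl 2)‖ ≤ 1 := by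
  have h1 : (z : PadicAlgCl 2) = algebraMap ℚ_[2] (PadicAlgCl 2) (z : ℚ_[2]) := (map_intCast _ z).symm
  rw [h1, PadicAlgCl.norm_extends]
  exact Padic.norm_int_le_one z

/-- `num r ⊥ den r`. -/
private theorem isCoprime_num_den_ev (r : ℚ) : IsCoprime r.num (r.den : ℤ) := by
  rw [Int.isCoprime_iff_gcd_eq_one]
  have := r.reduced
  simpa [Int.gcd] using this

/-- `p_N` is odd (`N ≥ 2`). -/
private theorem odd_psNumer_ev {N : ℕ} (hN : 2 ≤ N) : Odd ((psNumer 2 N : ℕ) : ℤ) := by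
  have h := coprime_psNumer 2 hN
  have h2 : ¬ 2 ∣ psNumer 2 N := by
    intro hd
    have := Nat.Coprime.eq_one_of_dvd (Nat.Coprime.symm h) hd
    omega
  rw [Int.odd_iff]
  omega


/-! ### §4 The lift of a level point to the cover, read in `ℂ₂` (the tree's §7 at `‖λ‖₂ = 2^{−v}`) -/

/-- **THE LIFT, READ 2-ADICALLY.**  At a level `N`, a rational `r = u/d` (`u, d` odd) with `F_A = −(g·p_N)²`,
`F_Q = g²·2^{N!}·(2p_N + 2^{N!})` is the image of the point `(r, ±g·p_N/d², ±g·(p_N + 2^{N!})/d²)` of the cover;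
for ONE of the two signs the integer `I` has `‖I‖₂ ≤ (2/(‖D‖₂·2^{−v}))·2^{−3·N!}` (`2·2^{−N!} < ‖D‖₂·2^{−v}`). -/
theorem exists_sign_small_ev {Q A : ℤ[X]} (𝒞 : DescentCertE Q A) {N : ℕ} {r : ℚ} {g : ℤ}
    (hu : Odd r.num) (hd : Odd (r.den : ℤ))
    (hFA : hf A 4 r = -(g * ((psNumer 2 N : ℕ) : ℤ)) ^ 2)
    (hFQ : hf Q 4 r = g ^ 2 * ((2 : ℤ) ^ N ! * (2 * ((psNumer 2 N : ℕ) : ℤ) + (2 : ℤ) ^ N !)))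
    (hε : 2 * (1 / 2 : ℝ) ^ N ! < ‖(𝒞.D : PadicAlgCl 2)‖ * (1 / 2 : ℝ) ^ 𝒞.v) :
    ∃ σ : ℤ, (σ = 1 ∨ σ = -1) ∧
      ‖(dsI 𝒞.F0 𝒞.F1 𝒞.F2 𝒞.F3 𝒞.D r (σ * (g * psNumer 2 N))
          (σ * (g * (psNumer 2 N + 2 ^ N !))) : PadicAlgCl 2)‖ ≤
        2 / (‖(𝒞.D : PadicAlgCl 2)‖ * (1 / 2 : ℝ) ^ 𝒞.v) * (1 / 2 : ℝ) ^ (3 * N !) := by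
  -- the data in `ℂ₂`
  set p : ℤ := ((psNumer 2 N : ℕ) : ℤ) with hp
  set q : ℤ := (2 : ℤ) ^ N ! with hq
  set ε : ℝ := (1 / 2 : ℝ) ^ N ! with hεdef
  set mv : ℝ := (1 / 2 : ℝ) ^ 𝒞.v with hmv
  set y : PadicAlgCl 2 := (r : PadicAlgCl 2) with hydef
  set dK : PadicAlgCl 2 := ((r.den : ℕ) : PadicAlgCl 2) with hdK
  set DK : PadicAlgCl 2 := (𝒞.D : PadicAlgCl 2) with hDK
  set μ : PadicAlgCl 2 := (((2 : ℤ) ^ 𝒞.v * 3 ^ 𝒞.j : ℤ) : PadicAlgCl 2) with hμdef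
  have hdn : ‖dK‖ = 1 := by have := norm_eq_one_of_odd_ds hd; rwa [Int.cast_natCast] at this
  have hun : ‖(r.num : PadicAlgCl 2)‖ = 1 := norm_eq_one_of_odd_ds hu
  have hd0 : dK ≠ 0 := norm_pos_iff.mp (by rw [hdn]; norm_num)
  have hyud : y = (r.num : PadicAlgCl 2) / dK := by
    rw [hydef, hdK, Rat.cast_def]
  have hyn : ‖y‖ = 1 := by rw [hyud, norm_div, hun, hdn, div_one]
  have hD0 : 0 < ‖DK‖ := norm_intCast_pos_ds 𝒞.hD
  have hD1 : ‖DK‖ ≤ 1 := norm_intCast_le_one_ev _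
  have hμn : ‖μ‖ = mv := norm_two_pow_three_pow_ev 𝒞.v 𝒞.j
  have hmv0 : 0 < mv := by positivity
  have hmv1 : mv ≤ 1 := pow_le_one₀ (by norm_num) (by norm_num)
  have hqn : ‖(q : PadicAlgCl 2)‖ = ε := by rw [hq]; push_cast; rw [norm_pow, norm_two_Cp]
  have hε0 : 0 < ε := by positivity
  have hε1 : 2 * ε < ‖DK‖ * mv := hε
  have hεD : ε < ‖DK‖ * mv := by linarith
  have hle1 : ∀ F : ℤ[X], ‖aeval y F‖ ≤ 1 := fun F => norm_aeval_le_one_ds F hyn.le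
  -- the values of `Q`, `A`, `B = Q − A`
  have hQdeg : Q.natDegree ≤ 4 := 𝒞.eis.deg.le
  have hAdeg : A.natDegree ≤ 4 := 𝒞.hA.trans (by norm_num)
  have hQv : dK ^ 4 * aeval y Q = (g : PadicAlgCl 2) ^ 2 * ((q : PadicAlgCl 2) * (2 * p + q)) := by
    have := hf_cast_Cp hQdeg r; rw [hFQ] at this; push_cast at this; rw [← hdK, ← hydef] at this
    rw [← this]
  have hAv : dK ^ 4 * aeval y A = -((g : PadicAlgCl 2) * p) ^ 2 := by
    have := hf_cast_Cp hAdeg r; rw [hFA] at this; push_cast at this; rw [← hdK, ← hydef] at this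
    rw [← this]
  set ζ₁ : PadicAlgCl 2 := ((g * p : ℤ) : PadicAlgCl 2) / dK ^ 2 with hζ₁
  set ζ₂ : PadicAlgCl 2 := ((g * (p + q) : ℤ) : PadicAlgCl 2) / dK ^ 2 with hζ₂
  have hd2 : dK ^ 2 ≠ 0 := pow_ne_zero 2 hd0
  have hd4 : dK ^ 4 ≠ 0 := pow_ne_zero 4 hd0
  have hA' : aeval y A = -ζ₁ ^ 2 := by
    rw [hζ₁]; push_cast
    field_simp
    linear_combination hAv
  have hB' : aeval y (Q - A) = ζ₂ ^ 2 := by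
    rw [hζ₂, map_sub]; push_cast
    field_simp
    linear_combination hQv - hAv
  have hQn : ‖aeval y Q‖ ≤ ε := by
    have e : aeval y Q = (g : PadicAlgCl 2) ^ 2 * ((q : PadicAlgCl 2) * (2 * p + q)) / dK ^ 4 := by
      rw [← hQv]; field_simp
    rw [e, norm_div, norm_pow, hdn, one_pow, div_one, norm_mul, norm_mul, norm_pow, hqn]
    have h1 : ‖(g : PadicAlgCl 2)‖ ^ 2 ≤ 1 := pow_le_one₀ (norm_nonneg _) (norm_intCast_le_one_ev g)
    have h2 : ‖(2 * (p : PadicAlgCl 2) + q)‖ ≤ 1 := by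
      have := norm_intCast_le_one_ev (2 * p + q); push_cast at this; exact this
    calc ‖(g : PadicAlgCl 2)‖ ^ 2 * (ε * ‖2 * (p : PadicAlgCl 2) + (q : PadicAlgCl 2)‖) ≤ 1 * (ε * 1) := by
          gcongr
      _ = ε := by ring
  have hζd : ‖ζ₂ - ζ₁‖ ≤ ε := by
    have e : ζ₂ - ζ₁ = (g : PadicAlgCl 2) * q / dK ^ 2 := by rw [hζ₁, hζ₂]; push_cast; field_simp; ring
    rw [e, norm_div, norm_pow, hdn, one_pow, div_one, norm_mul, hqn]
    calc ‖(g : PadicAlgCl 2)‖ * ε ≤ 1 * ε := mul_le_mul_of_nonneg_right (norm_intCast_le_one_ev g) hε0.le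
      _ = ε := one_mul ε
  have hζn : ∀ z : ℤ, ‖((z : ℤ) : PadicAlgCl 2) / dK ^ 2‖ ≤ 1 := fun z => by
    rw [norm_div, norm_pow, hdn, one_pow, div_one]; exact norm_intCast_le_one_ev z
  have hζ2n : ‖ζ₂‖ ≤ 1 := hζn _
  -- the certificate, evaluated at `y`
  have hRid : aeval y 𝒞.Rz ^ 2 + DK ^ 2 * aeval y A = aeval y Q ^ 3 * aeval y 𝒞.U₁ := by
    have := congrArg (aeval y) 𝒞.hR
    simpa only [map_add, map_mul, map_pow, map_intCast] using this
  have hSid : aeval y 𝒞.Sz ^ 2 - DK ^ 2 * aeval y (Q - A) = aeval y Q ^ 3 * aeval y 𝒞.U₂ := by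
    have := congrArg (aeval y) 𝒞.hS
    simpa only [map_add, map_sub, map_mul, map_pow, map_intCast] using this
  have hRV : aeval y 𝒞.Rz = DK * μ * y ^ 3 + aeval y Q * aeval y 𝒞.V := by
    have := congrArg (aeval y) 𝒞.hRV
    simpa only [map_add, map_mul, map_pow, map_intCast, aeval_X] using this
  have hSW : aeval y 𝒞.Sz = aeval y 𝒞.Rz + aeval y Q * aeval y 𝒞.W := by
    have := congrArg (aeval y) 𝒞.hSW
    simpa only [map_add, map_mul] using this
  have hΩ : DK ^ 2 * aeval y 𝒞.F0 + DK * aeval y 𝒞.F1 * aeval y 𝒞.Rz + DK * aeval y 𝒞.F2 * aeval y 𝒞.Sz +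
      aeval y 𝒞.F3 * aeval y 𝒞.Rz * aeval y 𝒞.Sz = aeval y Q ^ 3 * aeval y 𝒞.Om := by
    have := congrArg (aeval y) 𝒞.hOm
    simpa only [map_add, map_mul, map_pow, map_intCast] using this
  -- `‖Rz(y)‖ = ‖D‖·2^{−v}` and the sign choice
  have hRn : ‖aeval y 𝒞.Rz‖ = ‖DK‖ * mv := by
    have h1 : ‖DK * μ * y ^ 3‖ = ‖DK‖ * mv := by rw [norm_mul, norm_mul, norm_pow, hμn, hyn]; ring
    have h2 : ‖aeval y Q * aeval y 𝒞.V‖ < ‖DK * μ * y ^ 3‖ := by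
      rw [h1, norm_mul]
      exact lt_of_le_of_lt (mul_le_of_le_one_right (norm_nonneg _) (hle1 _)) (hQn.trans_lt hεD)
    rw [hRV, norm_add_eq_of_lt_ds h2, h1]
  obtain ⟨s, hs, hR1⟩ := sign_choice_ev (mul_pos hD0 hmv0) hQn (hle1 𝒞.U₁) hA' hRid hRn
  obtain ⟨σ, hσ, hσs⟩ : ∃ σ : ℤ, (σ = 1 ∨ σ = -1) ∧ (σ : PadicAlgCl 2) = s := by
    rcases hs with rfl | rfl
    · exact ⟨1, Or.inl rfl, by push_cast; rfl⟩
    · exact ⟨-1, Or.inr rfl, by push_cast; rfl⟩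
  have hσ2 : (σ : PadicAlgCl 2) ^ 2 = 1 := by rcases hσ with rfl | rfl <;> norm_num
  have hσn : ‖(σ : PadicAlgCl 2)‖ = 1 := by rcases hσ with rfl | rfl <;> simp
  -- Runge on the cover at the signed point
  have hB'' : aeval y (Q - A) = (s * ζ₂) ^ 2 := by rw [← hσs, mul_pow, hσ2, one_mul]; exact hB'
  have hζ'' : ‖s * ζ₂ - s * ζ₁‖ ≤ ε := by rw [← mul_sub, norm_mul, ← hσs, hσn, one_mul]; exact hζd
  have hζ2'' : ‖s * ζ₂‖ ≤ 1 := by rw [norm_mul, ← hσs, hσn, one_mul]; exact hζ2n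
  have hmain := runge_cover_ev (F0 := aeval y 𝒞.F0) hyn hμn hmv0 hmv1 hD0 hD1 hQn hε1 (hle1 𝒞.V) (hle1 𝒞.W)
    (hle1 𝒞.U₂) (hle1 𝒞.F1) (hle1 𝒞.F2) (hle1 𝒞.F3) (hle1 𝒞.Om) hζ2'' hB'' hζ'' hSid hRV hSW hΩ hR1
  refine ⟨σ, hσ, ?_⟩
  -- the integer `I`, read in `ℂ₂`, is `d⁵ ×` the value bounded by `hmain`
  have hI : (dsI 𝒞.F0 𝒞.F1 𝒞.F2 𝒞.F3 𝒞.D r (σ * (g * psNumer 2 N)) (σ * (g * (psNumer 2 N + 2 ^ N !))) :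
      PadicAlgCl 2) = dK ^ 5 * (DK ^ 2 * aeval y 𝒞.F0 + DK * aeval y 𝒞.F1 * (DK * (s * ζ₁)) +
        DK * aeval y 𝒞.F2 * (DK * (s * ζ₂)) + aeval y 𝒞.F3 * (DK * (s * ζ₁)) * (DK * (s * ζ₂))) := by
    rw [dsI]; push_cast
    rw [hf_cast_Cp 𝒞.hF0, hf_cast_Cp 𝒞.hF1, hf_cast_Cp 𝒞.hF2, hf_cast_Cp 𝒞.hF3, ← hdK, ← hydef, ← hDK, ← hσs,
      hζ₁, hζ₂, hp, hq]
    push_cast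
    field_simp
  rw [hI, norm_mul, norm_pow, hdn, one_pow, one_mul]
  refine hmain.trans (le_of_eq ?_)
  have e3 : ε ^ 3 = (1 / 2 : ℝ) ^ (3 * N !) := by rw [hεdef, ← pow_mul, mul_comm]
  rw [e3]; ring

/-! ### §5 THE ENGINE: `LevelFinite` (hence `ThinFibreAt m₀` for every `m₀`) from an even-class certificate -/

/-- **`ν(r) = 0` ABOVE `N₀(C)`.**  With an even-class descent certificate, every level point `(s_N, r)`, `N ≥ N₀(C)`,
`|r| ≤ C` has `ν(r) = 0`: DESCENT (`descent_ev`) lifts it to the double cover with `z₁ = σgp`, `z₂ = σg(p+q)`,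
`g ∣ λ = 2^v3^j`; the 2-adic Runge step (`exists_sign_small_ev`) gives `‖I‖₂ ≤ (2/(‖D‖₂2^{−v}))·2^{−3N!}`; the
archimedean floor gives `den(r)² ≤ K₃·2^{N!}` and `|I| ≤ K₄·den(r)·4^{N!}`; the product formula and `5 < 6`
(tree `endgame_ds`) force `I = 0`, i.e. `Φ = 0` at the lifted point, whence `ν(r) = 0` (tree `nu_eq_zero_of_phi`). -/
theorem nu_root_of_level_ev {Q A : ℤ[X]} (𝒞 : DescentCertE Q A) (C : ℝ) :
    ∃ N₀ : ℕ, ∀ N : ℕ, N₀ ≤ N → ∀ r : ℚ, |(r : ℝ)| ≤ C → bev (dsP Q A) (partialSum 2 N) r = 0 →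
      aeval r (dsNu Q A 𝒞.F0 𝒞.F1 𝒞.F2 𝒞.F3) = 0 := by
  classical
  -- the constants of the window `C`
  have hl0 : (0 : ℤ) < (2 : ℤ) ^ 𝒞.v * 3 ^ 𝒞.j := by positivity
  set L : ℝ := (((2 : ℤ) ^ 𝒞.v * 3 ^ 𝒞.j : ℤ) : ℝ) with hL
  have hL0 : 0 < L := by rw [hL]; exact_mod_cast hl0
  have hcopQ := isCoprime_of_bezout 𝒞.hbez 𝒞.hm
  obtain ⟨c₀, hc₀, hfloor⟩ := exists_arch_floor A (Q - A) hcopQ C 1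
  obtain ⟨M0, -, hM0⟩ := exists_abs_aeval_le 𝒞.F0 C
  obtain ⟨M1, -, hM1⟩ := exists_abs_aeval_le 𝒞.F1 C
  obtain ⟨M2, -, hM2⟩ := exists_abs_aeval_le 𝒞.F2 C
  obtain ⟨M3, -, hM3⟩ := exists_abs_aeval_le 𝒞.F3 C
  set K₃ : ℝ := max 1 (9 * L ^ 2 / c₀) with hK₃
  have hK₃1 : 1 ≤ K₃ := le_max_left _ _
  have hK₃2 : 9 * L ^ 2 / c₀ ≤ K₃ := le_max_right _ _
  set K₄ : ℝ := (𝒞.D : ℝ) ^ 2 * (M0 * K₃ ^ 2 + 2 * L * M1 * K₃ + 3 * L * M2 * K₃ + 6 * L ^ 2 * M3) with hK₄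
  have hDn : 0 < ‖(𝒞.D : PadicAlgCl 2)‖ := norm_intCast_pos_ds 𝒞.hD
  have hDm : 0 < ‖(𝒞.D : PadicAlgCl 2)‖ * (1 / 2 : ℝ) ^ 𝒞.v := by positivity
  set KD : ℝ := 2 / (‖(𝒞.D : PadicAlgCl 2)‖ * (1 / 2 : ℝ) ^ 𝒞.v) with hKD
  obtain ⟨n₁, hn₁⟩ := exists_pow_lt_of_lt_one (half_pos hDm) (by norm_num : (1 / 2 : ℝ) < 1)
  obtain ⟨n₂, hn₂⟩ := pow_unbounded_of_one_lt (KD ^ 2 * K₄ ^ 2 * K₃) (by norm_num : (1 : ℝ) < 2)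
  refine ⟨max 3 (max n₁ n₂), fun N hN r hrC hlev0 => ?_⟩
  have hN3 : 3 ≤ N := le_trans (le_max_left _ _) hN
  have hNn₁ : n₁ ≤ N := le_trans (le_trans (le_max_left _ _) (le_max_right _ _)) hN
  have hNn₂ : n₂ ≤ N := le_trans (le_trans (le_max_right _ _) (le_max_right _ _)) hN
  have hNf : N ≤ N ! := Nat.self_le_factorial N
  -- THE DESCENT (with `p := p_N`, `q := 2^{N!}` generalised)
  obtain ⟨p, hp⟩ : ∃ p : ℤ, ((psNumer 2 N : ℕ) : ℤ) = p := ⟨_, rfl⟩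
  obtain ⟨q, hq⟩ : ∃ q : ℤ, (2 : ℤ) ^ N ! = q := ⟨_, rfl⟩
  have hp0 : 0 < p := by rw [← hp]; exact_mod_cast psNumer_pos_runge N
  have hq0 : 0 < q := by rw [← hq]; positivity
  have hpq : p < 2 * q := by rw [← hp, ← hq]; exact_mod_cast psNumer_lt N
  have hpodd : Odd p := by rw [← hp]; exact odd_psNumer_ev (by omega)
  have hQdeg : Q.natDegree ≤ 4 := 𝒞.eis.deg.le
  have hAdeg : A.natDegree ≤ 4 := 𝒞.hA.trans (by norm_num)
  have hlev := level_eq_int hQdeg hAdeg hlev0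
  rw [hp, hq] at hlev
  obtain ⟨g, hg0, hgl, hFA, hFQ, hu, hd⟩ := descent_ev (e := N !) (j := 𝒞.j) (v := 𝒞.v) (FT := hf 𝒞.T 2 r)
    hq.symm (le_trans hN3 hNf) rfl hpodd hp0 (isCoprime_num_den_ev r) (hf_Q_expand 𝒞.eis r)
    𝒞.eis.c1 hlev (hom_identity hQdeg hAdeg 𝒞.hTdeg 𝒞.hT r)
  have hgl' : g ≤ (2 : ℤ) ^ 𝒞.v * 3 ^ 𝒞.j := Int.le_of_dvd hl0 hgl
  -- THE 2-ADIC SIDE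
  have hε : 2 * (1 / 2 : ℝ) ^ N ! < ‖(𝒞.D : PadicAlgCl 2)‖ * (1 / 2 : ℝ) ^ 𝒞.v := by
    have h1 : (1 / 2 : ℝ) ^ N ! ≤ (1 / 2) ^ n₁ :=
      pow_le_pow_of_le_one (by norm_num) (by norm_num) (hNn₁.trans hNf)
    linarith
  obtain ⟨σ, hσ, hnorm⟩ := exists_sign_small_ev 𝒞 hu hd (by rw [hp]; exact hFA) (by rw [hp, hq]; exact hFQ) hε
  rw [hp, hq] at hnorm
  have hpf : dsI 𝒞.F0 𝒞.F1 𝒞.F2 𝒞.F3 𝒞.D r (σ * (g * p)) (σ * (g * (p + q))) ≠ 0 →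
      ((2 : ℝ) ^ N !) ^ 3 ≤ KD * |(dsI 𝒞.F0 𝒞.F1 𝒞.F2 𝒞.F3 𝒞.D r (σ * (g * p)) (σ * (g * (p + q))) : ℝ)| :=
    fun h0 => by
    have := two_pow_le_of_norm_le h0 (K := KD) (m := 3 * N !) (by rw [hKD]; exact hnorm)
    rwa [pow_mul'] at this
  -- THE ARCHIMEDEAN SIDE
  have hqR : ((q : ℤ) : ℝ) = (2 : ℝ) ^ N ! := by rw [← hq]; push_cast; ring
  obtain ⟨hz1, hz2⟩ := abs_lift_le_ds hp0 hq0 hg0 hgl' hpq hσ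
  rw [hqR] at hz1 hz2
  have hd0R : (0 : ℝ) < (r.den : ℝ) := by exact_mod_cast r.pos
  have hAr : (r.den : ℝ) ^ 4 * aeval (r : ℝ) A = -(((g * p : ℤ) : ℝ)) ^ 2 := by
    rw [← hf_cast_real hAdeg, hFA]; push_cast; ring
  have hBr : (r.den : ℝ) ^ 4 * aeval (r : ℝ) (Q - A) = (((g * (p + q) : ℤ) : ℝ)) ^ 2 := by
    rw [map_sub, mul_sub, ← hf_cast_real hAdeg, ← hf_cast_real hQdeg, hFQ, hFA]; push_cast; ring
  have hZ : |(((g * p : ℤ) : ℝ))| ≤ |(((g * (p + q) : ℤ) : ℝ))| := by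
    have h1 : (0 : ℝ) ≤ ((g * p : ℤ) : ℝ) := by exact_mod_cast (mul_pos hg0 hp0).le
    have h2 : ((g * p : ℤ) : ℝ) ≤ ((g * (p + q) : ℤ) : ℝ) := by
      exact_mod_cast mul_le_mul_of_nonneg_left (le_add_of_nonneg_right hq0.le) hg0.le
    rw [abs_of_nonneg h1, abs_of_nonneg (h1.trans h2)]; exact h2
  have hc₀B : c₀ ≤ |aeval (r : ℝ) (Q - A)| := hfloor _ hrC (abs_A_le_abs_B_ds hd0R hAr hBr hZ)
  have hz2' : |(((g * (p + q) : ℤ) : ℝ))| ≤ 3 * L * (2 : ℝ) ^ N ! := by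
    have : |((σ * (g * (p + q)) : ℤ) : ℝ)| = |(((g * (p + q) : ℤ) : ℝ))| := by
      push_cast; rw [abs_mul (σ : ℝ), show |((σ : ℤ) : ℝ)| = 1 by rcases hσ with rfl | rfl <;> simp, one_mul]
    rw [← this]; exact hz2
  have hd2 : (r.den : ℝ) ^ 2 ≤ K₃ * (2 : ℝ) ^ N ! :=
    den_sq_le_ds hd0R hc₀ hc₀B hBr hz2' hK₃2 hK₃1 (by positivity)
  have habs := abs_dsI_le 𝒞.hF0 𝒞.hF1 𝒞.hF2 𝒞.hF3 hM0 hM1 hM2 hM3 𝒞.D hrC hL0.le (by positivity) hz1 hz2 hd2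
  -- THE ENDGAME: `I = 0`
  have hbig : KD ^ 2 * K₄ ^ 2 * K₃ < (2 : ℝ) ^ N ! :=
    lt_of_lt_of_le hn₂ (pow_le_pow_right₀ one_le_two (hNn₂.trans hNf))
  have hI0 := endgame_ds (by positivity) hpf habs hd2 hbig
  -- `Φ = 0` at the lifted point, read in `ℚ`, and `ν(r) = 0`
  have hD0 : (𝒞.D : ℚ) ≠ 0 := by exact_mod_cast 𝒞.hD
  have hd0 : (r.den : ℚ) ≠ 0 := by exact_mod_cast r.den_nz
  have hσ2 : ((σ : ℤ) : ℚ) ^ 2 = 1 := by rcases hσ with rfl | rfl <;> norm_num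
  have hJ : (𝒞.D : ℚ) ^ 2 * ((r.den : ℚ) ^ 5 * aeval r 𝒞.F0 + (r.den : ℚ) ^ 3 * aeval r 𝒞.F1 * ((σ * (g * p) : ℤ) : ℚ)
      + (r.den : ℚ) ^ 3 * aeval r 𝒞.F2 * ((σ * (g * (p + q)) : ℤ) : ℚ)
      + (r.den : ℚ) ^ 1 * aeval r 𝒞.F3 * (((σ * (g * p) : ℤ) : ℚ) * ((σ * (g * (p + q)) : ℤ) : ℚ))) = 0 := by
    have := congrArg (fun t : ℤ => (t : ℚ)) hI0
    simp only [dsI, Int.cast_mul, Int.cast_add, Int.cast_pow, Int.cast_zero, hf_cast 𝒞.hF0, hf_cast 𝒞.hF1,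
      hf_cast 𝒞.hF2, hf_cast 𝒞.hF3] at this
    push_cast
    linear_combination this
  have hΦ := phi_zero_of_I_zero_ds hD0 hd0 hJ
  have hAq : (r.den : ℚ) ^ 4 * aeval r A = (-1) * (((g * p : ℤ) : ℚ)) ^ 2 := by
    rw [← hf_cast hAdeg, hFA]; push_cast; ring
  have hBq : (r.den : ℚ) ^ 4 * aeval r (Q - A) = 1 * (((g * (p + q) : ℤ) : ℚ)) ^ 2 := by
    rw [map_sub, mul_sub, ← hf_cast hAdeg, ← hf_cast hQdeg, hFQ, hFA]; push_cast; ring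
  have h1 := sq_lift_ds hd0 hσ2 (by norm_num) hAq
  have h2 := sq_lift_ds hd0 hσ2 (by norm_num) hBq
  rw [neg_one_mul] at h1
  rw [one_mul] at h2
  have e1 : (((σ * (g * p) : ℤ) : ℚ)) / (r.den : ℚ) ^ 2 = ((σ : ℤ) : ℚ) * (((g * p : ℤ) : ℚ)) / (r.den : ℚ) ^ 2 := by
    push_cast; ring
  have e2 : (((σ * (g * (p + q)) : ℤ) : ℚ)) / (r.den : ℚ) ^ 2 =
      ((σ : ℤ) : ℚ) * (((g * (p + q) : ℤ) : ℚ)) / (r.den : ℚ) ^ 2 := by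
    push_cast; ring
  rw [e1, e2] at hΦ
  rw [aeval_dsNu]
  exact nu_eq_zero_of_phi h1 h2 hΦ

/-- **THE ENGINE, even class.**  An even-class descent certificate for `(Q, A)` makes `LevelFinite (Q·x² + A·(2x+1))`
UNCONDITIONAL: above `N₀(C)` the level points have `ν(r) = 0` (`nu_root_of_level_ev`), `ν ≠ 0` has finitely many
rational roots (tree `roots_finite_ds`), and each non-degenerate `r` lies on finitely many levels (tree
`levels_finite_of_nondeg`). -/
theorem levelFinite_of_descentCertE {Q A : ℤ[X]} (𝒞 : DescentCertE Q A) : LevelFinite (dsP Q A) := by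
  classical
  intro C
  obtain ⟨N₀, hN₀⟩ := nu_root_of_level_ev 𝒞 C
  set R : Set ℚ := {r : ℚ | aeval r (dsNu Q A 𝒞.F0 𝒞.F1 𝒞.F2 𝒞.F3) = 0 ∧ ∃ x : ℝ, bev (dsP Q A) x r ≠ 0}
    with hR
  have hRfin : R.Finite := (roots_finite_ds _ 𝒞.hnu).subset fun r hr => hr.1
  have hU : (⋃ r ∈ R, {N : ℕ | bev (dsP Q A) (partialSum 2 N) r = 0}).Finite :=
    hRfin.biUnion fun r hr => levels_finite_of_nondeg _ r hr.2
  refine ((Set.finite_lt_nat N₀).union hU).subset ?_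
  rintro N ⟨r, hrC, hP, hnd⟩
  by_cases hN : N < N₀
  · exact Or.inl hN
  · refine Or.inr (Set.mem_biUnion (x := r) ?_ ?_)
    · exact ⟨hN₀ N (not_lt.mp hN) r hrC hP, hnd⟩
    · exact hP

/-- … hence the K-line residual `ThinFibreAt m₀` for EVERY `m₀` (tree glue `thinFibreAt_of_levelFinite`). -/
theorem thinFibreAt_of_descentCertE {Q A : ℤ[X]} (𝒞 : DescentCertE Q A) (m₀ : ℕ) : ThinFibreAt m₀ (dsP Q A) :=
  thinFibreAt_of_levelFinite (levelFinite_of_descentCertE 𝒞) m₀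

end Summit.Schanuel.Schanuel.Theorems.RootDecomp1KDescentEven

end
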